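import Literature.GroupTheory.CombinatorialGroupTheory.SurfaceGroupPushout
import Literature.GroupTheory.CombinatorialGroupTheory.AmalgamCentralizers
import HarnessLib

/-!
# Abelian subgroups of orientable surface groups are cyclic

Topic `Literature/GroupTheory/CombinatorialGroupTheory`; theorems only.  For `g ≥ 2` every
abelian subgroup of the surface group `S_g = ⟨a₁, b₁, …, a_g, b_g ∣ ∏ [aᵢ, bᵢ]⟩` (the tree's
`Literature.Topology.FourManifolds.SurfaceGroup g`) is cyclic — classically seen on the
hyperbolic plane (Lyndon–Schupp, Ch. I Prop. 7.? / Zieschang–Vogt–Coldewey 4.11: centralizers in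
planar discontinuous groups without reflections are cyclic); here purely algebraically:
`S_g ≅ F_{2g-2} *_ℤ F_2` (`SurfaceGroupPushout.lean`), the amalgamated `ℤ = ⟨∏_{i<g-1}[aᵢ,bᵢ]⟩`
is malnormal in both free factors since the surface relator is not a proper power, free groups
are torsion free with cyclic centralizers, and the centralizer theorem for such amalgams
(`AmalgamCentralizers.lean`) applies.

* `SurfaceAmalgam.isCyclic_of_forall_commute` — abelian subgroups of `F_{2g} *_ℤ F_{2h}`
  (`g, h ≥ 1`) are cyclic;
* `isCyclic_of_forall_commute_of_mulEquiv` — transport along a group isomorphism;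
* `surfaceGroup_isCyclic_of_forall_commute` — **abelian subgroups of `S_n`, `n ≥ 2`, are cyclic**;
  `surfaceGroup_isCyclic_centralizer` — centralizers of non-trivial elements of `S_n` are cyclic.

This is the orientable-surface-group half of [IUTchI] Lemma 2.7 (iv) (Mochizuki: "well-known").

## References

* R. C. Lyndon, P. E. Schupp, *Combinatorial Group Theory*, Springer (1977); Classics in
  Mathematics (2001), Ch. IV Thm. 2.8 and Ch. I §7. [LyndonSchupp2001]
* W. Magnus, A. Karrass, D. Solitar, *Combinatorial Group Theory*, Interscience (1966), §4.2
  Cor. 4.5. [MagnusKarrassSolitar1966]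
-/

noncomputable section

namespace Literature.GroupTheory.CombinatorialGroupTheory

open Literature.Topology.FourManifolds Monoid

/-- **Abelian subgroups of `F_{2g} *_ℤ F_{2h}` (`g, h ≥ 1`) are cyclic.**
[cite: MagnusKarrassSolitar1966, §4.2 Cor. 4.5] -/
theorem SurfaceAmalgam.isCyclic_of_forall_commute {g h : ℕ} (hg : 1 ≤ g) (hh : 1 ≤ h)
    (J : Subgroup (SurfaceAmalgam g h)) (hJ : ∀ a ∈ J, ∀ b ∈ J, a * b = b * a) : IsCyclic J :=
  Amalgam.isCyclic_of_forall_commute (surfaceAmalgamHom_injective hg hh)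
    (surfaceAmalgam_malnormal hg hh) (fun b x hx => surfaceAmalgam_isCyclic_centralizer b x hx)
    (fun _ _ => inferInstance) J hJ

/-- **Centralizers of non-trivial elements of `F_{2g} *_ℤ F_{2h}` (`g, h ≥ 1`) are cyclic.**
[cite: MagnusKarrassSolitar1966, §4.2 Cor. 4.5] -/
theorem SurfaceAmalgam.isCyclic_centralizer {g h : ℕ} (hg : 1 ≤ g) (hh : 1 ≤ h)
    {x : SurfaceAmalgam g h} (hx : x ≠ 1) :
    IsCyclic (Subgroup.centralizer ({x} : Set (SurfaceAmalgam g h))) :=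
  Amalgam.isCyclic_centralizer (surfaceAmalgamHom_injective hg hh)
    (surfaceAmalgam_malnormal hg hh) (fun b x hx => surfaceAmalgam_isCyclic_centralizer b x hx)
    (fun _ _ => inferInstance) hx

/-- Transport of "every abelian subgroup is cyclic" along a group isomorphism.
[cite: LyndonSchupp2001, Ch. I §7] -/
theorem isCyclic_of_forall_commute_of_mulEquiv {A : Type*} [Group A] {B : Type*} [Group B]
    (e : A ≃* B) (hB : ∀ J : Subgroup B, (∀ a ∈ J, ∀ b ∈ J, a * b = b * a) → IsCyclic J)
    (J : Subgroup A) (hJ : ∀ a ∈ J, ∀ b ∈ J, a * b = b * a) : IsCyclic J := by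
  have hJ' : ∀ a ∈ J.map (e : A →* B), ∀ b ∈ J.map (e : A →* B), a * b = b * a := by
    rintro _ ⟨a, ha, rfl⟩ _ ⟨b, hb, rfl⟩
    rw [MonoidHom.coe_coe, ← map_mul, ← map_mul, hJ a ha b hb]
  haveI := hB _ hJ'
  exact isCyclic_of_surjective (e.subgroupMap J).symm (e.subgroupMap J).symm.surjective

/-- Transport of "centralizers of non-trivial elements are cyclic" along a group isomorphism.
[cite: LyndonSchupp2001, Ch. I §7] -/
theorem isCyclic_centralizer_of_mulEquiv {A : Type*} [Group A] {B : Type*} [Group B]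
    (e : A ≃* B) (hB : ∀ y : B, y ≠ 1 → IsCyclic (Subgroup.centralizer ({y} : Set B)))
    {x : A} (hx : x ≠ 1) : IsCyclic (Subgroup.centralizer ({x} : Set A)) := by
  have heq : (Subgroup.centralizer ({x} : Set A)).map (e : A →* B) =
      Subgroup.centralizer ({e x} : Set B) := by
    ext y
    constructor
    · rintro ⟨a, ha, rfl⟩
      rw [SetLike.mem_coe, Subgroup.mem_centralizer_singleton_iff] at ha
      rw [Subgroup.mem_centralizer_singleton_iff, MonoidHom.coe_coe, ← map_mul, ha, map_mul]
    · intro hy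
      refine ⟨e.symm y, ?_, by simp⟩
      rw [Subgroup.mem_centralizer_singleton_iff] at hy
      rw [SetLike.mem_coe, Subgroup.mem_centralizer_singleton_iff]
      apply e.injective
      rw [map_mul, map_mul, MulEquiv.apply_symm_apply, hy]
  haveI : IsCyclic ((Subgroup.centralizer ({x} : Set A)).map (e : A →* B)) := by
    rw [heq]; exact hB _ (by simpa using hx)
  exact isCyclic_of_surjective (e.subgroupMap _).symm (e.subgroupMap _).symm.surjective

/-- **Abelian subgroups of the surface group `S_n` (`n ≥ 2`) are cyclic.**
[cite: MagnusKarrassSolitar1966, §4.2 Cor. 4.5] -/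
theorem surfaceGroup_isCyclic_of_forall_commute {n : ℕ} (hn : 2 ≤ n) (J : Subgroup (SurfaceGroup n))
    (hJ : ∀ a ∈ J, ∀ b ∈ J, a * b = b * a) : IsCyclic J := by
  obtain ⟨g, rfl⟩ : ∃ g, n = g + 1 := ⟨n - 1, by omega⟩
  obtain ⟨e, -, -⟩ := exists_surfaceGroup_mulEquiv_surfaceAmalgam g 1
  exact isCyclic_of_forall_commute_of_mulEquiv e
    (SurfaceAmalgam.isCyclic_of_forall_commute (by omega) le_rfl) J hJ

/-- **Centralizers of non-trivial elements of the surface group `S_n` (`n ≥ 2`) are cyclic.**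
[cite: MagnusKarrassSolitar1966, §4.2 Cor. 4.5] -/
theorem surfaceGroup_isCyclic_centralizer {n : ℕ} (hn : 2 ≤ n) {x : SurfaceGroup n} (hx : x ≠ 1) :
    IsCyclic (Subgroup.centralizer ({x} : Set (SurfaceGroup n))) := by
  obtain ⟨g, rfl⟩ : ∃ g, n = g + 1 := ⟨n - 1, by omega⟩
  obtain ⟨e, -, -⟩ := exists_surfaceGroup_mulEquiv_surfaceAmalgam g 1
  exact isCyclic_centralizer_of_mulEquiv e
    (fun y hy => SurfaceAmalgam.isCyclic_centralizer (by omega) le_rfl hy) hx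

end Literature.GroupTheory.CombinatorialGroupTheory
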